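import Mathlib.Analysis.Normed.Ring.InfiniteSum
import Mathlib.Analysis.SpecificLimits.Normed
import Mathlib.Analysis.Complex.Basic
import Mathlib.RingTheory.PowerSeries.Basic
import Mathlib.Algebra.Polynomial.BigOperators
import HarnessLib

/-!
# Convergence of a formal Hecke series with geometrically bounded coefficients

Topic `NumberTheory/Automorphic`; theorems only (Mathlib analysis), the analytic complement of
`TamagawaHeckeSeries` (Tamagawa's rationality theorem `(∑_m r_m X^m) · P(X) = 1` in `ℂ⟦X⟧` for
the eigenvalues `r_m` of the operators `T(ϖ^m)` and the Hecke polynomial `P`). Shimura (1971),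
§3.2, after Thm. 3.24: "the above result concerning the Euler product, if it converges, gives an
analytic statement". Here is that passage from formal to analytic identities, in the generality of
an arbitrary coefficient sequence:

* `tsum_mul_eval_eq_one_of_mk_mul_eq_one`: if `(∑ r_m X^m) · P = 1` in `ℂ⟦X⟧` for a polynomial
  `P` and `‖r_m‖ ≤ A D^m`, then for `‖x‖ D < 1` the series `∑ r_m x^m` converges absolutely and
  `(∑' r_m x^m) · P(x) = 1` (Cauchy product, Mathlib
  `tsum_mul_tsum_eq_tsum_sum_antidiagonal_of_summable_norm`, and `PowerSeries.coeff_mul`);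
* `eval_ne_zero_of_mk_mul_eq_one`, `tsum_eq_inv_eval_of_mk_mul_eq_one`: hence `P(x) ≠ 0` and
  `∑' r_m x^m = P(x)⁻¹` in that disc;
* `tsum_mul_prod_one_sub_eq_one`: the Euler-factor form, `P = ∏_{a ∈ α} (1 - c a X)`:
  `(∑' r_m x^m) · ∏_{a ∈ α} (1 - c a x) = 1`, the shape produced by
  `TamagawaHeckeSeries.mk_heckeDetEigenvalue_mul_eulerFactor_eq_one` (with `c = q^{(n-1)/2}`,
  `x = q^{-s'}`), i.e. `∑_m r_m q^{-m s'} = ∏_a (1 - a q^{-s})⁻¹`, the local Euler factor of the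
  standard `L`-function in the unramified computation of Godement–Jacquet (1972), Lemma 6.10.

In the intended application `r_m` is the eigenvalue of `T(ϖ^m)` on a spherical vector of a unitary
representation, bounded by the number of left cosets `#(Δ_m K / K) ≤ #(K t_1 K / K)^m`
(`TamagawaHeckeSeries.ncard_cosets_glIntDet_le`), so `D = #(K t_1 K / K) = (q^n - 1)/(q - 1)`.

## References

* G. Shimura, *Introduction to the arithmetic theory of automorphic functions* (1971), §3.2,
  Thm. 3.21 and the remarks following Thm. 3.24 (PDF p. 83 of the 1973 printing held in the
  literature store) [ShimuraIATAF1971].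
-/

noncomputable section

open Polynomial

namespace Literature.NumberTheory.Automorphic

/-- **From the formal to the analytic Hecke series.** If `(∑ r_m X^m) · P = 1` in `ℂ⟦X⟧` for a
polynomial `P` and the coefficients are geometrically bounded, `‖r_m‖ ≤ A D^m` (`D ≥ 0`), then
for `‖x‖ D < 1` the series `∑ r_m x^m` converges absolutely and `(∑' r_m x^m) · P(x) = 1`.
[folklore] -/
theorem tsum_mul_eval_eq_one_of_mk_mul_eq_one {r : ℕ → ℂ} {P : ℂ[X]}
    (h : PowerSeries.mk r * (P : PowerSeries ℂ) = 1) {A D : ℝ} (hD : 0 ≤ D)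
    (hr : ∀ m, ‖r m‖ ≤ A * D ^ m) {x : ℂ} (hx : ‖x‖ * D < 1) :
    Summable (fun m => ‖r m * x ^ m‖) ∧ (∑' m, r m * x ^ m) * P.eval x = 1 := by
  classical
  -- absolute convergence by comparison with a geometric series
  have hgeom : Summable fun m : ℕ => A * (D * ‖x‖) ^ m :=
    (summable_geometric_of_lt_one (mul_nonneg hD (norm_nonneg x)) (by rwa [mul_comm])).mul_left A
  have hsum : Summable fun m => ‖r m * x ^ m‖ := by
    refine Summable.of_nonneg_of_le (fun m => norm_nonneg _) (fun m => ?_) hgeom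
    rw [norm_mul, norm_pow, mul_pow, ← mul_assoc]
    exact mul_le_mul_of_nonneg_right (hr m) (pow_nonneg (norm_nonneg x) m)
  refine ⟨hsum, ?_⟩
  -- the polynomial as a finitely supported series
  set b : ℕ → ℂ := fun i => P.coeff i * x ^ i with hb
  have hbsupp : ∀ i ∉ Finset.range (P.natDegree + 1), b i = 0 := by
    intro i hi
    rw [Finset.mem_range, not_lt] at hi
    simp [hb, Polynomial.coeff_eq_zero_of_natDegree_lt hi]
  have hbsum : Summable fun i => ‖b i‖ := by
    apply summable_of_ne_finset_zero (s := Finset.range (P.natDegree + 1))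
    intro i hi
    rw [hbsupp i hi, norm_zero]
  have heval : P.eval x = ∑' i, b i := by
    rw [tsum_eq_sum (s := Finset.range (P.natDegree + 1)) (fun i hi => hbsupp i hi),
      Polynomial.eval_eq_sum_range]
  rw [heval, tsum_mul_tsum_eq_tsum_sum_antidiagonal_of_summable_norm hsum hbsum]
  -- the `N`-th Cauchy coefficient is `x^N · coeff_N (mk r * P) = [N = 0]`
  have hcoef : ∀ N : ℕ, ∑ p ∈ Finset.HasAntidiagonal.antidiagonal N, r p.1 * x ^ p.1 * b p.2 =
      if N = 0 then (1 : ℂ) else 0 := by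
    intro N
    have hN := congrArg (PowerSeries.coeff N) h
    rw [PowerSeries.coeff_mul, PowerSeries.coeff_one] at hN
    simp only [PowerSeries.coeff_mk, Polynomial.coeff_coe] at hN
    calc ∑ p ∈ Finset.HasAntidiagonal.antidiagonal N, r p.1 * x ^ p.1 * b p.2
        = (∑ p ∈ Finset.HasAntidiagonal.antidiagonal N, r p.1 * P.coeff p.2) * x ^ N := by
          rw [Finset.sum_mul]
          refine Finset.sum_congr rfl fun p hp => ?_
          have hp' : p.1 + p.2 = N := Finset.HasAntidiagonal.mem_antidiagonal.mp hp
          simp only [hb]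
          rw [← hp', pow_add]
          ring
      _ = if N = 0 then (1 : ℂ) else 0 := by
          rw [hN]
          split_ifs with h0
          · rw [h0, pow_zero, mul_one]
          · rw [zero_mul]
  simp_rw [hcoef]
  rw [tsum_ite_eq 0 (fun _ => (1 : ℂ))]

/-- In the disc `‖x‖ D < 1` the polynomial `P` of `tsum_mul_eval_eq_one_of_mk_mul_eq_one` does not
vanish. [folklore] -/
theorem eval_ne_zero_of_mk_mul_eq_one {r : ℕ → ℂ} {P : ℂ[X]}
    (h : PowerSeries.mk r * (P : PowerSeries ℂ) = 1) {A D : ℝ} (hD : 0 ≤ D)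
    (hr : ∀ m, ‖r m‖ ≤ A * D ^ m) {x : ℂ} (hx : ‖x‖ * D < 1) : P.eval x ≠ 0 := by
  intro h0
  have h1 := (tsum_mul_eval_eq_one_of_mk_mul_eq_one h hD hr hx).2
  rw [h0, mul_zero] at h1
  exact zero_ne_one h1

/-- `∑' r_m x^m = P(x)⁻¹` in the disc `‖x‖ D < 1`. [folklore] -/
theorem tsum_eq_inv_eval_of_mk_mul_eq_one {r : ℕ → ℂ} {P : ℂ[X]}
    (h : PowerSeries.mk r * (P : PowerSeries ℂ) = 1) {A D : ℝ} (hD : 0 ≤ D)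
    (hr : ∀ m, ‖r m‖ ≤ A * D ^ m) {x : ℂ} (hx : ‖x‖ * D < 1) :
    ∑' m, r m * x ^ m = (P.eval x)⁻¹ :=
  eq_inv_of_mul_eq_one_left (tsum_mul_eval_eq_one_of_mk_mul_eq_one h hD hr hx).2

/-- **Euler-factor form.** If `(∑ r_m X^m) · ∏_{a ∈ α} (1 - c a X) = 1` in `ℂ⟦X⟧` (the output of
Tamagawa's identity in Satake form, `c = q^{(n-1)/2}`) and `‖r_m‖ ≤ A D^m`, then for `‖x‖ D < 1`:
`(∑' r_m x^m) · ∏_{a ∈ α} (1 - c a x) = 1`; with `x = q^{-s'}`, `s' = s + (n-1)/2`, the product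
is the inverse local Euler factor `∏_a (1 - a q^{-s})` (Godement–Jacquet (1972), Lemma 6.10;
Shimura (1971), §3.2). [folklore] -/
theorem tsum_mul_prod_one_sub_eq_one {r : ℕ → ℂ} {α : Multiset ℂ} {c : ℂ}
    (h : PowerSeries.mk r *
      ((α.map fun a => (1 : ℂ[X]) - Polynomial.C (c * a) * Polynomial.X).prod : ℂ[X]) = 1)
    {A D : ℝ} (hD : 0 ≤ D) (hr : ∀ m, ‖r m‖ ≤ A * D ^ m) {x : ℂ} (hx : ‖x‖ * D < 1) :
    Summable (fun m => ‖r m * x ^ m‖) ∧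
      (∑' m, r m * x ^ m) * (α.map fun a => 1 - c * a * x).prod = 1 := by
  obtain ⟨hs, h1⟩ := tsum_mul_eval_eq_one_of_mk_mul_eq_one h hD hr hx
  refine ⟨hs, ?_⟩
  rw [Polynomial.eval_multiset_prod, Multiset.map_map] at h1
  have e : (α.map fun a => 1 - c * a * x) =
      α.map ((fun p : ℂ[X] => p.eval x) ∘ fun a => (1 : ℂ[X]) - Polynomial.C (c * a) * Polynomial.X) := by
    refine Multiset.map_congr rfl fun a _ => ?_
    simp
  rw [e]
  exact h1

end Literature.NumberTheory.Automorphic
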